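import Summits.QuantumFields.YangMills.Theorems.FluctuationComparisonRegPrIntLS2BetaArgminOrbitOfTower
import HarnessLib

/-!
# S2β · THE (BKG) SUB-LETTER OF THE GAUGED PAIRING LETTER (F♮) FROM THE THM-1 PAIR — «every argmin good history over an interior datum has fine plaquettes
# `≤ C₁·θ_J·L^{−2(K−J)}`» = [Balaban1985Variational] Thm 1 (9)∕(2) at the datum's regularity `θ_J`, by ✓px13 g21's equality chain; OUTRIGHT at every `L ≥ 5`

Cell `ym3-torus` (YM ladder rung R3 = continuum `SU(2)` Yang–Mills on the three-torus at fixed lattice data — a RUNG: NOT d = 4, NOT infinite volume, NOT a mass gap,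
NOT Clay).  Width seat `ym3-torus-px5` (gen 22) on the holder's word (px16 g21 11:41:53Z «px5 g22 — WELCOME on (BKG) … LOCATE first: what
✓`…S2BetaArgminOrbitOfTower.regPr_of_argmin` ∕ `Thm1GlobalMinAt` ∕ ✓`…MinimalOrbitContinuousOn` already give, then the door»); crux `stmt-QuantumFields-20520`
(`…Theses.UnitScaleTilt.FluctuationComparisonRegPrIntL`), LINE g18-1 S2β, organ GAP♯∘ (registered `stub_uniformFibreGapOrbit`, registry `Lines/semiclassical_s2beta.lean`
UNTOUCHED) ⟸ the gauged letters {(D♮), (F♮)} (✓p821904 `…S2BetaStrataOfGaugedLetters`, ★★OWNER RULING №88) and (F♮) ⟸ «CRIT♮» ∧ (BKG) (px16 g21 SIGNATURE (3)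
`…S2BetaPairingOfTangentLetters.pairingLetter_of_tangentLetters (G) (hCrit) (hBkg)`, UV3-NODE §75.8 (3)); `--kind proof --supports stmt-QuantumFields-20520 --as helper`,
count-neutral, DEFINITION-FREE (0 `def`, 0 `instance`, 0 `notation`, 0 `sorry`, default heartbeats).

THE LOCATE (answer to «what the tree already gives»).  (BKG)'s text is «`∀ U₀ ∈ argminHist V, ∀ p, dist1 U₀∂p ≤ C₁·θBal(b₀)(J)·(L⁻¹)^{2(K−J)}`» in the
registry prefix with the INTERIOR window `PlaqSmall (θBal(cw·b₀)(J)) V` and an arbitrary guard `G F J V`.  ✓`…S2BetaArgminOrbitOfTower` (px13 g21, FILE D) proves,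
from the Thm-1 PAIR `Thm1GlobalMinAt L a₀ a₁ B₃ ∧ Thm1UniqueMinOrbitAt L a₀ a₁ B₃` at one block size: `exists_onMinimalOrbit_sameOrbit_of_argmin` — an argmin good
history `U` over `V` (depth `K − J ≥ 1`) is a residual translate `w • U_J` of an (8)-MINIMISER `U_J ∈ regFibrePr F J K _ (B₃·θ J) V` — and `regPr_of_argmin` — `U ∈ (6)(ε₀)`.
The first is EXACTLY Thm 1 (9) at radius `B₃·θ_J`: `U_J ∈ (8)(B₃θ_J)` says `|U_J(∂p) − 1| < B₃θ_J·L^{−2(K−J)}` for every fine plaquette ((2) p.278 with `ε := B₃ε₁`,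
the tree's `RegPr F J K (B₃θ J) = PlaqSmall (regThreshold …) ∧ DivSmall`, `regThreshold = ε·(L⁻¹)^{2(K−J)}`), and (2) is gauge invariant (lit ✓`regPr_gaugeAct_iff`),
so `U = w • U_J` has the same plaquette sizes.  `regPr_of_argmin` alone gives only the CLASS radius `ε₀` (px16: «NOT at the class parameter ε₀ — the (F♮) door needs a
coefficient that → 0 with γ»); the orbit statement gives the datum's `θ_J`.  ✓`…MinimalOrbitContinuousOn` (continuity of `V ↦ minActionRegPr`) is not needed.  Depth
`K = J`: `U = V` and `histGood` gives `dist1 V∂p < θ_J` directly, whence the harmless `C₁ := max B₃ 1`.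

WHAT IS PROVED (sorry-free).
* §1 ★★`dist1_plaqHol_le_of_argmin` — under FILE D §1's hypotheses (the pair at `(L, a₀, a₁, B₃)`, `ε₀ ≤ a₀`, a threshold profile `θ` with `θ i ≤ a₁`, `B₃θ_iL³ ≤ ε₀`,
  `4θ_iL³ < ε₀`), every depth `K − J ≥ 0`: a good history `U` over `V` with `A(U) = minActionRegPr F J K ε₀ V` has `dist1 U∂p ≤ max B₃ 1·θ J·(L⁻¹)^{2(K−J)}` for all `p`.
* §2 in the registry's prefix and interior window, for EVERY guard `G` (`c₀ := 1`, `pS := 0`, `ε₁ := a₀`, `γ₁` by lit ✓`exists_forall_θBal_le` exactly as FILE D's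
  `argminRegularOrbit_at`, `C₁ := max B₃ 1`): ★★★`bkgLetter_at (hT) (hU1)` — the (BKG) binder text of `pairingLetter_of_tangentLetters` VERBATIM at one `L`;
  ★★★`bkgLetter_of_thm1Pair` (∀ `L` from the pair letter; even∕`L ≤ 1` vacuous by `F.hL`); `bkgLetter_of_thm1PairAtThree` (from the `L = 3` pair ALONE, ✓`thm1Pair_allL_of_three`);
  ★★★`bkgLetter_body_five (L) (h5 : 5 ≤ L)` — OUTRIGHT, ZERO HYPOTHESES (✓`thm1Pair_five`).

CONSUMER.  px16 g21's (F♮) door takes `(hBkg : ∀ L, …)` = `bkgLetter_of_thm1Pair hT` (or the `AtThree` edition); at a fixed `L ≥ 5` the body is `bkgLetter_body_five L h5`.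
So of (F♮)'s sub-letters {(T♮), (CRIT-m♮), (MULT♮), (AVG₂♮), (BKG)} the last is DISCHARGED modulo the `L = 3` Thm-1 pair (EMBARGO-LITE №58) and outright at `L ≥ 5`.

HONEST.  Composition BY NAME of ✓px13 g21's FILE D with lit's gauge invariance of (2) + threshold arithmetic; the analytic content is the tree's Thm 1 pair at `L ≥ 5`
(the 19200 guarded chain); nothing of Bałaban's analysis is added here; «CRIT♮» ((T♮)(CRIT-m♮)(MULT♮)(AVG₂♮)), (D♮), GAP♯∘'s uniform order, the five REGISTERED stubs
(every `L`), S2β, crux 20520, 19936, 19200 and `YM3TorusSU2` are NOT proved; no summit statement is proved by a helper; rung R3 = SU(2) YM₃ on T³ at fixed lattice data —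
NOT d = 4, NOT infinite volume, NOT a mass gap, NOT Clay; the Yang–Mills mass gap is NOT proved.  Axioms standard.

References: T. Bałaban, CMP **102** (1985) 277–309 [Balaban1985Variational] ((2)–(8) p.278, Thm 1 (8)–(10) p.279, Prop. 7 p.299); CMP **102** (1985) 255–275 [Balaban1985UV3]
((7) p.257, (41)–(42) p.266, (44) p.267 «The configuration U_k satisfies the following regularity condition»); CMP **109** (1987) [Balaban1987RG1] ((0.21) p.256).
-/

set_option autoImplicit false

noncomputable section

namespace Summit.QuantumFields.YangMills.Theorems.FluctuationComparisonRegPrIntLS2BetaBackgroundLetterOfThm1Pair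

open Literature.MathematicalPhysics.QuantumFieldTheory.Balaban1983to89
open Literature.MathematicalPhysics.QuantumFieldTheory.Balaban1983to89.T3ContinuumYM3Torus
open Literature.MathematicalPhysics.QuantumFieldTheory.Balaban1983to89.T3UnitLawDensityEML (ℰp)
open Literature.MathematicalPhysics.QuantumFieldTheory.Balaban1983to89.T3UnitScaleTilt
open Literature.MathematicalPhysics.QuantumFieldTheory.Balaban1983to89.T3TiltDescent
open Literature.MathematicalPhysics.QuantumFieldTheory.Balaban1983to89.T3ConstrainedMinimiser (fibre)
open Literature.MathematicalPhysics.QuantumFieldTheory.Balaban1983to89.T3DescentFibreTower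
open Literature.MathematicalPhysics.QuantumFieldTheory.Balaban1983to89.T3RegularMinimiser
open Literature.MathematicalPhysics.QuantumFieldTheory.Balaban1983to89.T3PrintedRegularMinimiser
open Literature.MathematicalPhysics.QuantumFieldTheory.Balaban1983to89.T3PrintedMinimiserExistence
open Literature.MathematicalPhysics.QuantumFieldTheory.Balaban1983to89.T3PrintedRegularOrbits (regPr_gaugeAct_iff)
open Literature.MathematicalPhysics.QuantumFieldTheory.Balaban1983to89.T3Thm1Carrier (SameOrbit varProblem3)
open Literature.MathematicalPhysics.QuantumFieldTheory.Balaban1983to89.T3Thm1UniquenessSchema (Thm1UniqueMinOrbitAt)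
open Literature.MathematicalPhysics.QuantumFieldTheory.Balaban1983to89.T3MinimiserStabilityReduction (θBal_pos)
open Literature.MathematicalPhysics.QuantumFieldTheory.Balaban1983to89.T3ThresholdSmallness (exists_forall_θBal_le)
open Literature.MathematicalPhysics.QuantumFieldTheory.Balaban1983to89.T4Continuum
open Summit.QuantumFields.YangMills.Theorems.FluctuationComparisonRegPrIntLS2BetaWindowExactnessOfTower (plaqSmall_descendTo_of_histGood)
open Summit.QuantumFields.YangMills.Theorems.FluctuationComparisonRegPrIntLS2BetaSymmetriesLiftOfCritical (thm1Pair_five thm1Pair_allL_of_three)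
open Summit.QuantumFields.YangMills.Theorems.FluctuationComparisonRegPrIntLS2BetaArgminOrbitOfTower (exists_onMinimalOrbit_sameOrbit_of_argmin)

/-! ## §1 The plaquette bound at the chain level: an argmin good history has Thm 1 (9)-small fine plaquettes at the datum's regularity -/

section Chain

variable {F : T3Family}

/-- ★★ **THM 1 (9) FOR ARGMIN GOOD HISTORIES, AT THE DATUM's REGULARITY**: under FILE D §1's hypotheses, a good history `U` over `V` with
`A(U) = minActionRegPr F J K ε₀ V` satisfies `dist1 U∂p ≤ max B₃ 1·θ J·(L⁻¹)^{2(K−J)}` for every fine plaquette (`U = w • U_J`, `U_J ∈ (8)(B₃θ J)`, (2) gauge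
invariant; depth 0: `U = V`, `histGood`). [cite: Balaban1985Variational, Thm 1 (8)-(10) p.279, (2) p.278] -/
theorem dist1_plaqHol_le_of_argmin {L : ℕ} {a₀ a₁ B₃ : ℝ} (hT : Thm1GlobalMinAt L a₀ a₁ B₃) (hU1 : Thm1UniqueMinOrbitAt L a₀ a₁ B₃)
    (hB₃ : 0 < B₃) (hFL : F.L = L) {ε₀ : ℝ} (hε₀ : 0 < ε₀) (hε₀a : ε₀ ≤ a₀) {θ : ℕ → ℝ} (hθpos : ∀ i, 0 < θ i)
    (hθa : ∀ i, θ i ≤ a₁) (hθB : ∀ i, B₃ * θ i * (F.L : ℝ) ^ 3 ≤ ε₀) (hθ4 : ∀ i, 4 * θ i * (F.L : ℝ) ^ 3 < ε₀)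
    {J K : ℕ} (hJK : J ≤ K) {V : GaugeField (F.P J) 0 (Matrix.specialUnitaryGroup (Fin 2) ℂ)}
    {U : GaugeField (F.P K) 0 (Matrix.specialUnitaryGroup (Fin 2) ℂ)} (hUf : U ∈ fibre F ℰp J K hJK V) (hUg : U ∈ histGood F ℰp θ K J)
    (hA : wilsonAction4 U = minActionRegPr F J K hJK ε₀ V) (p : Plaq (F.P K) 0) :
    dist1 (GaugeField.plaqHol U p) ≤ max B₃ 1 * θ J * ((F.L : ℝ)⁻¹) ^ (2 * (K - J)) := by
  have hL1 : (1 : ℝ) ≤ (F.L : ℝ) := by exact_mod_cast (by have := F.hL.2; omega : 1 ≤ F.L)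
  have hLinv : (0 : ℝ) ≤ (F.L : ℝ)⁻¹ := inv_nonneg.mpr (zero_le_one.trans hL1)
  rcases Nat.eq_or_lt_of_le hJK with hEq | hlt
  · -- depth 0: `U = V` and the good history puts `U` in the `θ J`-window
    subst hEq
    have hpl : PlaqSmall (θ J) U := by
      have h := plaqSmall_descendTo_of_histGood F hUg le_rfl le_rfl
      rwa [descendTo_self] at h
    have h1 : dist1 (GaugeField.plaqHol U p) < θ J := hpl p
    rw [Nat.sub_self, mul_zero, pow_zero, mul_one]
    have h2 : θ J ≤ max B₃ 1 * θ J := by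
      have := le_max_right B₃ 1
      nlinarith [hθpos J]
    exact h1.le.trans h2
  · -- depth ≥ 1: `U = w • U_J` with `U_J ∈ (8)(B₃θ J)`; (2) is gauge invariant
    obtain ⟨UJ, hon, w, -, hUw⟩ := exists_onMinimalOrbit_sameOrbit_of_argmin hT hU1 hB₃ hFL hε₀ hε₀a hθpos hθa hθB hθ4 hlt hUf hUg hA
    have hreg : RegPr F J K (B₃ * θ J) U := by
      rw [hUw, regPr_gaugeAct_iff F (mul_pos hB₃ (hθpos J)).le]
      exact ((mem_regFibrePr_iff F).mp hon.1).2
    have h1 : dist1 (GaugeField.plaqHol U p) < B₃ * θ J * ((F.L : ℝ)⁻¹) ^ (2 * (K - J)) := hreg.plaqSmall p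
    have h2 : B₃ * θ J * ((F.L : ℝ)⁻¹) ^ (2 * (K - J)) ≤ max B₃ 1 * θ J * ((F.L : ℝ)⁻¹) ^ (2 * (K - J)) :=
      mul_le_mul_of_nonneg_right (mul_le_mul_of_nonneg_right (le_max_left B₃ 1) (hθpos J).le) (pow_nonneg hLinv _)
    exact h1.le.trans h2

end Chain

/-! ## §2 The (BKG) binder text on the interior window, registry prefix — at one block size from the pair there; at every `L` from the pair letter; from `L = 3` alone; OUTRIGHT at `L ≥ 5` -/

section Window

/-- ★★★ **(BKG) AT ONE BLOCK SIZE FROM THE THM-1 PAIR AT THAT BLOCK SIZE**, for every guard `G` (`c₀ := 1`, `pS := 0`, `ε₁ := a₀`, `γ₁` so that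
`θBal(b₀)(i) ≤ min a₁ (ε₀∕(2(4+B₃)L³))` — FILE D's choice verbatim —, `C₁ := max B₃ 1`): the (BKG) hypothesis text of px16 g21's `pairingLetter_of_tangentLetters`,
body at `L`. [cite: Balaban1985Variational, Thm 1 (8)-(10) p.279, (2) p.278; Balaban1985UV3, (7) p.257, (44) p.267] -/
theorem bkgLetter_at {L : ℕ} (hL1 : 1 < L) {a₀ a₁ B₃ : ℝ} (ha₀ : 0 < a₀) (ha₁ : 0 < a₁) (hB₃ : 0 < B₃)
    (hT : Thm1GlobalMinAt L a₀ a₁ B₃) (hU1 : Thm1UniqueMinOrbitAt L a₀ a₁ B₃)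
    (G : (F : T3Family) → (J : ℕ) → GaugeField (F.P J) 0 (Matrix.specialUnitaryGroup (Fin 2) ℂ) → Prop) :
    ∃ c₀ : ℝ, 0 < c₀ ∧ c₀ ≤ 1 ∧ ∀ (cw : ℝ), 0 < cw → cw ≤ c₀ → ∃ pS : ℝ, ∀ (b₀ p₀ : ℝ), 0 < b₀ → pS ≤ p₀ → 0 < p₀ → ∃ ε₁ : ℝ, 0 < ε₁ ∧ ∀ (ε₀ : ℝ), 0 < ε₀ → ε₀ ≤ ε₁ →
    ∃ γ₁ : ℝ, 0 < γ₁ ∧ ∃ C₁ : ℝ, 0 ≤ C₁ ∧ ∀ (F : T3Family) (γ : ℝ), F.L = L → 0 < γ → γ ≤ γ₁ →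
      ∀ (J K : ℕ) (hJK : J ≤ K) (V : GaugeField (F.P J) 0 (Matrix.specialUnitaryGroup (Fin 2) ℂ)), PlaqSmall (θBal F.L γ (cw * b₀) p₀ J) V →
        G F J V →
        ∀ U₀ ∈ {U' : GaugeField (F.P K) 0 (Matrix.specialUnitaryGroup (Fin 2) ℂ) | U' ∈ fibre F ℰp J K hJK V ∧ U' ∈ histGood F ℰp (θBal F.L γ b₀ p₀) K J ∧
            wilsonAction4 U' = minActionRegPr F J K hJK ε₀ V},
        ∀ p : Plaq (F.P K) 0, dist1 (GaugeField.plaqHol U₀ p) ≤ C₁ * θBal F.L γ b₀ p₀ J * ((F.L : ℝ)⁻¹) ^ (2 * (K - J)) := by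
  have hL : 1 ≤ L := hL1.le
  have hL0 : (0 : ℝ) < (L : ℝ) := by exact_mod_cast (show 0 < L by omega)
  refine ⟨1, one_pos, le_rfl, fun cw hcw0 hcw1 => ⟨0, fun b₀ p₀ hb _ hp => ⟨a₀, ha₀, fun ε₀ hε₀ hε₀a => ?_⟩⟩⟩
  set c : ℝ := 2 * (4 + B₃) * (L : ℝ) ^ 3 with hc
  have hcpos : 0 < c := by positivity
  obtain ⟨γθ, hγθ, Hθ⟩ := exists_forall_θBal_le hL b₀ p₀ (lt_min ha₁ (div_pos hε₀ hcpos))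
  refine ⟨min γθ 1, lt_min hγθ one_pos, max B₃ 1, (hB₃.le).trans (le_max_left _ _), fun F γ hFL hγ hγle J K hJK V _ _ U₀ hU₀ p => ?_⟩
  have hγθ' : γ ≤ γθ := hγle.trans (min_le_left _ _)
  have hγ1 : γ ≤ 1 := hγle.trans (min_le_right _ _)
  have hθle : ∀ i, θBal F.L γ b₀ p₀ i ≤ min a₁ (ε₀ / c) := fun i => by rw [hFL]; exact Hθ γ hγ hγθ' i
  have hθpos : ∀ i, 0 < θBal F.L γ b₀ p₀ i := fun i => θBal_pos F.hL.2.le hγ hγ1 hb p₀ i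
  have hθa : ∀ i, θBal F.L γ b₀ p₀ i ≤ a₁ := fun i => (hθle i).trans (min_le_left _ _)
  have hθc : ∀ i, θBal F.L γ b₀ p₀ i * c ≤ ε₀ := fun i => by
    have h := (hθle i).trans (min_le_right _ _)
    rwa [le_div_iff₀ hcpos] at h
  have hFL3 : (F.L : ℝ) ^ 3 = (L : ℝ) ^ 3 := by rw [hFL]
  have hθB : ∀ i, B₃ * θBal F.L γ b₀ p₀ i * (F.L : ℝ) ^ 3 ≤ ε₀ := fun i => by
    have h1 : B₃ * (F.L : ℝ) ^ 3 ≤ c := by rw [hFL3, hc]; nlinarith [pow_pos hL0 3]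
    calc B₃ * θBal F.L γ b₀ p₀ i * (F.L : ℝ) ^ 3 = θBal F.L γ b₀ p₀ i * (B₃ * (F.L : ℝ) ^ 3) := by ring
      _ ≤ θBal F.L γ b₀ p₀ i * c := mul_le_mul_of_nonneg_left h1 (hθpos i).le
      _ ≤ ε₀ := hθc i
  have hθ4 : ∀ i, 4 * θBal F.L γ b₀ p₀ i * (F.L : ℝ) ^ 3 < ε₀ := fun i => by
    have h1 : 4 * (F.L : ℝ) ^ 3 < c := by rw [hFL3, hc]; nlinarith [pow_pos hL0 3]
    calc 4 * θBal F.L γ b₀ p₀ i * (F.L : ℝ) ^ 3 = θBal F.L γ b₀ p₀ i * (4 * (F.L : ℝ) ^ 3) := by ring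
      _ < θBal F.L γ b₀ p₀ i * c := mul_lt_mul_of_pos_left h1 (hθpos i)
      _ ≤ ε₀ := hθc i
  exact dist1_plaqHol_le_of_argmin hT hU1 hB₃ hFL hε₀ hε₀a hθpos hθa hθB hθ4 hJK hU₀.1 hU₀.2.1 hU₀.2.2 p

/-- ★★★ **(BKG) AT EVERY BLOCK SIZE FROM THE THM-1 PAIR LETTER** (even ∕ `L ≤ 1` vacuous by `F.hL`), for every guard `G` — the `hBkg` hypothesis of
`pairingLetter_of_tangentLetters` VERBATIM. [cite: Balaban1985Variational, Thm 1 (8)-(10) p.279, (2) p.278] -/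
theorem bkgLetter_of_thm1Pair
    (hT : ∀ L : ℕ, Odd L → 1 < L → ∃ a₀ a₁ B₃ : ℝ, 0 < a₀ ∧ 0 < a₁ ∧ 0 < B₃ ∧ Thm1GlobalMinAt L a₀ a₁ B₃ ∧ Thm1UniqueMinOrbitAt L a₀ a₁ B₃)
    (G : (F : T3Family) → (J : ℕ) → GaugeField (F.P J) 0 (Matrix.specialUnitaryGroup (Fin 2) ℂ) → Prop) :
    ∀ (L : ℕ), ∃ c₀ : ℝ, 0 < c₀ ∧ c₀ ≤ 1 ∧ ∀ (cw : ℝ), 0 < cw → cw ≤ c₀ → ∃ pS : ℝ, ∀ (b₀ p₀ : ℝ), 0 < b₀ → pS ≤ p₀ → 0 < p₀ → ∃ ε₁ : ℝ, 0 < ε₁ ∧ ∀ (ε₀ : ℝ), 0 < ε₀ → ε₀ ≤ ε₁ →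
    ∃ γ₁ : ℝ, 0 < γ₁ ∧ ∃ C₁ : ℝ, 0 ≤ C₁ ∧ ∀ (F : T3Family) (γ : ℝ), F.L = L → 0 < γ → γ ≤ γ₁ →
      ∀ (J K : ℕ) (hJK : J ≤ K) (V : GaugeField (F.P J) 0 (Matrix.specialUnitaryGroup (Fin 2) ℂ)), PlaqSmall (θBal F.L γ (cw * b₀) p₀ J) V →
        G F J V →
        ∀ U₀ ∈ {U' : GaugeField (F.P K) 0 (Matrix.specialUnitaryGroup (Fin 2) ℂ) | U' ∈ fibre F ℰp J K hJK V ∧ U' ∈ histGood F ℰp (θBal F.L γ b₀ p₀) K J ∧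
            wilsonAction4 U' = minActionRegPr F J K hJK ε₀ V},
        ∀ p : Plaq (F.P K) 0, dist1 (GaugeField.plaqHol U₀ p) ≤ C₁ * θBal F.L γ b₀ p₀ J * ((F.L : ℝ)⁻¹) ^ (2 * (K - J)) := by
  intro L
  by_cases hLodd : Odd L ∧ 1 < L
  · obtain ⟨a₀, a₁, B₃, ha₀, ha₁, hB₃, hT1, hU1⟩ := hT L hLodd.1 hLodd.2
    exact bkgLetter_at hLodd.2 ha₀ ha₁ hB₃ hT1 hU1 G
  · refine ⟨1, one_pos, le_rfl, fun cw _ _ => ⟨0, fun b₀ p₀ _ _ _ => ⟨1, one_pos, fun ε₀ _ _ => ⟨1, one_pos, 0, le_rfl, ?_⟩⟩⟩⟩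
    intro F γ hFL
    exact absurd (hFL ▸ F.hL) hLodd

/-- ★★★ **(BKG) AT EVERY BLOCK SIZE FROM THE `L = 3` THM-1 PAIR ALONE** (every `L ≥ 5` by ✓`thm1Pair_five`; `L = 3` = the [Balaban1985RegularSpaces] Thm-2 socket,
EMBARGO-LITE №58). [cite: Balaban1985Variational, Thm 1 p.279; Balaban1985RegularSpaces, Thm 2 p.83] -/
theorem bkgLetter_of_thm1PairAtThree
    (h3 : ∃ a₀ a₁ B₃ : ℝ, 0 < a₀ ∧ 0 < a₁ ∧ 0 < B₃ ∧ Thm1GlobalMinAt 3 a₀ a₁ B₃ ∧ Thm1UniqueMinOrbitAt 3 a₀ a₁ B₃)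
    (G : (F : T3Family) → (J : ℕ) → GaugeField (F.P J) 0 (Matrix.specialUnitaryGroup (Fin 2) ℂ) → Prop) :
    ∀ (L : ℕ), ∃ c₀ : ℝ, 0 < c₀ ∧ c₀ ≤ 1 ∧ ∀ (cw : ℝ), 0 < cw → cw ≤ c₀ → ∃ pS : ℝ, ∀ (b₀ p₀ : ℝ), 0 < b₀ → pS ≤ p₀ → 0 < p₀ → ∃ ε₁ : ℝ, 0 < ε₁ ∧ ∀ (ε₀ : ℝ), 0 < ε₀ → ε₀ ≤ ε₁ →
    ∃ γ₁ : ℝ, 0 < γ₁ ∧ ∃ C₁ : ℝ, 0 ≤ C₁ ∧ ∀ (F : T3Family) (γ : ℝ), F.L = L → 0 < γ → γ ≤ γ₁ →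
      ∀ (J K : ℕ) (hJK : J ≤ K) (V : GaugeField (F.P J) 0 (Matrix.specialUnitaryGroup (Fin 2) ℂ)), PlaqSmall (θBal F.L γ (cw * b₀) p₀ J) V →
        G F J V →
        ∀ U₀ ∈ {U' : GaugeField (F.P K) 0 (Matrix.specialUnitaryGroup (Fin 2) ℂ) | U' ∈ fibre F ℰp J K hJK V ∧ U' ∈ histGood F ℰp (θBal F.L γ b₀ p₀) K J ∧
            wilsonAction4 U' = minActionRegPr F J K hJK ε₀ V},
        ∀ p : Plaq (F.P K) 0, dist1 (GaugeField.plaqHol U₀ p) ≤ C₁ * θBal F.L γ b₀ p₀ J * ((F.L : ℝ)⁻¹) ^ (2 * (K - J)) :=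
  bkgLetter_of_thm1Pair (thm1Pair_allL_of_three h3) G

/-- ★★★ **(BKG) ON THE INTERIOR WINDOW AT EVERY BLOCK SIZE `L ≥ 5` — ZERO HYPOTHESES** (✓`thm1Pair_five` ∘ `bkgLetter_at`): for the `SU(2)` d = 3 torus family, every
good history realising the regular minimum over an interior datum has fine plaquettes `≤ C₁·θ_J·L^{−2(K−J)}`. [cite: Balaban1985Variational, Thm 1 (8)-(10) p.279] -/
theorem bkgLetter_body_five (L : ℕ) (h5 : 5 ≤ L)
    (G : (F : T3Family) → (J : ℕ) → GaugeField (F.P J) 0 (Matrix.specialUnitaryGroup (Fin 2) ℂ) → Prop) :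
    ∃ c₀ : ℝ, 0 < c₀ ∧ c₀ ≤ 1 ∧ ∀ (cw : ℝ), 0 < cw → cw ≤ c₀ → ∃ pS : ℝ, ∀ (b₀ p₀ : ℝ), 0 < b₀ → pS ≤ p₀ → 0 < p₀ → ∃ ε₁ : ℝ, 0 < ε₁ ∧ ∀ (ε₀ : ℝ), 0 < ε₀ → ε₀ ≤ ε₁ →
    ∃ γ₁ : ℝ, 0 < γ₁ ∧ ∃ C₁ : ℝ, 0 ≤ C₁ ∧ ∀ (F : T3Family) (γ : ℝ), F.L = L → 0 < γ → γ ≤ γ₁ →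
      ∀ (J K : ℕ) (hJK : J ≤ K) (V : GaugeField (F.P J) 0 (Matrix.specialUnitaryGroup (Fin 2) ℂ)), PlaqSmall (θBal F.L γ (cw * b₀) p₀ J) V →
        G F J V →
        ∀ U₀ ∈ {U' : GaugeField (F.P K) 0 (Matrix.specialUnitaryGroup (Fin 2) ℂ) | U' ∈ fibre F ℰp J K hJK V ∧ U' ∈ histGood F ℰp (θBal F.L γ b₀ p₀) K J ∧
            wilsonAction4 U' = minActionRegPr F J K hJK ε₀ V},
        ∀ p : Plaq (F.P K) 0, dist1 (GaugeField.plaqHol U₀ p) ≤ C₁ * θBal F.L γ b₀ p₀ J * ((F.L : ℝ)⁻¹) ^ (2 * (K - J)) := by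
  obtain ⟨a₀, a₁, B₃, ha₀, ha₁, hB₃, hT1, hU1⟩ := thm1Pair_five L h5
  exact bkgLetter_at (by omega) ha₀ ha₁ hB₃ hT1 hU1 G

end Window

end Summit.QuantumFields.YangMills.Theorems.FluctuationComparisonRegPrIntLS2BetaBackgroundLetterOfThm1Pair

end
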